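import Summits.ValiantsHypothesis.ValiantsHypothesis.Theses.BorderApolarity

/-!
# Route BorderApolarity — `ToricReduction` (item stmt-ValiantsHypothesis-14757)

Closes the support item `ToricReduction` of route `route-ValiantsHypothesis-BorderApolarity`
(sub-problem `ValiantsHypothesis`): the pure-logic glue

  `ToricFixedPoints → ToricWitnessObstructionQP → FixedWitnessObstructionQP`.

Given `c`, let `n₀` be the threshold of `ToricWitnessObstructionQP c` and take `n₀' := max n₀ 3`.
For `n ≥ n₀'` and `n ≤ m ≤ 2 ^ ((log₂ n + c) ^ c)`, suppose `(P, J)` is a Borel-fixed border-apolar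
witness as in `FixedWitnessObstructionQP` (W1 `P t ∈ GL·det_m`, W2/W3 `J` is the degree-wise
Kuratowski limit of the annihilators `Ann_k(P t)`, W4 `J` is `H₀(n,m)`-stable, W5 `J_k ⊆ Ann_k(pp)`,
`pp = X₀₀^(m-n) per_n`).  `ToricFixedPoints n m` (which needs `3 ≤ n ≤ m`, whence the `max`) turns
W1, W2 ∧ W3, W4 into `u g : GL_(m²)` and weights `w` such that the SAME `J` is the Kuratowski limit
along the toric curve `Q_t = u · diag((t+2)^w) · g · det_m`; W4 and W5 are properties of `J` alone
and carry over verbatim, so `(u, g, w, J)` is exactly a witness forbidden by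
`ToricWitnessObstructionQP c` at `(n, m)`.  The `let act / rk` bindings of the three decls are
syntactically identical, so after `simp only []` the proof is intro/obtain/exact (the same term as
the `have h_FixedWitnessObstructionQP` step of the route's deciding theorem `closes`).
-/

namespace Summit.ValiantsHypothesis.ValiantsHypothesis.Theorems

open Summit.ValiantsHypothesis.ValiantsHypothesis.Theses.BorderApolarity

/-- **`ToricReduction` holds** (support item stmt-ValiantsHypothesis-14757 of route
`BorderApolarity`, pure logic): the toric normal form of `H₀`-fixed limit points
(`ToricFixedPoints`) together with the absence of toric witnesses in the quasi-polynomial window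
(`ToricWitnessObstructionQP`) gives the absence of any Borel-fixed border-apolar witness there
(`FixedWitnessObstructionQP`); threshold `max n₀ 3`. -/
theorem toricReduction_proof :
    Summit.ValiantsHypothesis.ValiantsHypothesis.Theses.BorderApolarity.ToricReduction := by
  unfold ToricReduction
  intro hTFP hTWO c
  obtain ⟨n₀, hn₀⟩ := hTWO c
  refine ⟨max n₀ 3, ?_⟩
  intro n hn m inst hnm hm
  have h3n : 3 ≤ n := le_trans (le_max_right n₀ 3) hn
  have hn' : n ≥ n₀ := le_trans (le_max_left n₀ 3) hn
  have hWn := @hn₀ n hn' m inst hnm hm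
  have hTn := @hTFP n m inst h3n hnm
  simp only [] at hWn hTn ⊢
  rintro ⟨P, J, hP, hlo, hup, hstab, hpp⟩
  obtain ⟨u, g, w, hQ⟩ := hTn P J hP ⟨hlo, hup⟩ hstab
  exact hWn ⟨u, g, w, J, hQ.1, hQ.2, hstab, hpp⟩

end Summit.ValiantsHypothesis.ValiantsHypothesis.Theorems
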